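import Literature.Analysis.UnboundedOperators.UnitaryRepSpectralMeasure
import Literature.NumberTheory.Automorphic.ArchUnipotentDilationGL2
import HarnessLib

/-!
# The archimedean unipotent line of `GL_2` as a unitary representation of `K_∞`, its spectral
# measures, and the dilation integral along the torus `a(y)`

Topic `NumberTheory/Automorphic`; namespace `Literature.NumberTheory.Automorphic`. Sequel of
`ArchUnipotentDilationGL2` (the elements `n(x)`, `a(y)` of `GL_2(𝔸_K)`, `x ∈ K_∞`, `y ∈ K_∞ˣ`, and the
right-regular operators `U_x = R(n(x))`) and of
`Literature.Analysis.UnboundedOperators.UnitaryRepSpectralMeasure` (Stone–Bochner spectral measures and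
the abstract dilation integral). We PROVE:

* `archUnipotentHom` (definition, a `ContinuousMonoidHom`) and `archUnipotentRep` (definition) — the
  restriction of the right regular representation of `GL_2(𝔸_K)` on `L²(GL_2(K) A_G \ GL_2(𝔸_K))` to
  the archimedean unipotent line, a (strongly continuous) unitary representation of the additive group
  `K_∞ = mixedSpace K` (`UnitaryRep (Multiplicative (mixedSpace K)) L²`, `archUnipotentRep_apply`);
* `matrixCoeff_rightRegular_archDilation` — its matrix coefficients at a torus translate `R(a(y)) f` are
  the dilated ones of `f`: `⟪R(a(y))f, U_x R(a(y))f⟫ = ⟪f, U_{y⁻¹x} f⟫`;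
* `mixedMulAct` (definition) — the linear action of `K_∞ˣ` on `K_∞` by multiplication, symmetric for
  the character form `B(ξ, x) = -2π Tr(ξ x)` (`archCharForm_mixedMulAct`);
* `lintegral_weight_mul_norm_sq_kirillovKernel_le` (**the dilation integral for `GL_2`**): for
  `f ∈ L²`, a left-invariant σ-finite measure `ν` on `K_∞ˣ`, a multiplicative weight `χ` on `K_∞ˣ`
  matched with a weight `W` on `K_∞` (`W(y ξ) = χ(y) W(ξ)`, `W(1) = 1`) and a kernel
  `g ∈ L¹(K_∞)` whose `B`-Fourier transform vanishes off the units,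

    `∫_{K_∞ˣ} χ(y) ‖∫ g(x) U_x R(a(y)) f dx‖² dν(y) ≤ (∫ χ(z) |ĝ(z⁻¹)|² dν(z)) · ∫ W dμ_f`,

  `μ_f` the spectral measure of `f` — the abelian half of the `L²`-bound of the global Whittaker
  coefficient along the archimedean torus of `GL_2` (the Kirillov integral of the Rankin–Selberg
  method at `s = 1`, Jacquet–Langlands (1970), §2; Jacquet–Shalika (1981), §3–§4), obtained from
  `UnitaryRep.lintegral_weight_mul_norm_sq_integral_smul_le`.

## References

* H. Jacquet, R. P. Langlands, *Automorphic forms on GL(2)*, LNM 114 (1970), §2 [JacquetLanglands1970].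
* H. Jacquet, J. A. Shalika, *On Euler products and the classification of automorphic
  representations I*, Amer. J. Math. 103 (1981), §3–§4 [JacquetShalikaAJM1981].
* G. B. Folland, *A course in abstract harmonic analysis* (1995), Thm. 4.44 [Folland1995].
-/

noncomputable section

open scoped MatrixGroups InnerProductSpace ENNReal Classical
open NumberField NumberField.mixedEmbedding IsDedekindDomain MeasureTheory Complex
open Literature.Analysis.UnboundedOperators

namespace Literature.NumberTheory.Automorphic

variable {K : Type} [Field K] [NumberField K]
  (μ : Measure (AdelicGroupData.gl 2 K).automorphicQuotient) [(AdelicGroupData.gl 2 K).IsAutomorphicMeasure μ]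

/-! ### The unipotent line as a unitary representation of `K_∞` -/

variable (K) in
/-- **`x ↦ (n(x), 1)` as a continuous homomorphism** `Multiplicative K_∞ →ₜ* GL_2(𝔸_K)` (adelic-group
typed). [folklore] -/
def archUnipotentHom : Multiplicative (mixedSpace K) →ₜ* (AdelicGroupData.gl 2 K).Adelic where
  toFun x := archUnipotentAdelic K x.toAdd
  map_one' := archUnipotentAdelic_zero
  map_mul' _ _ := archUnipotentAdelic_add _ _
  continuous_toFun := continuous_archUnipotentAdelic.comp continuous_toAdd

/-- Unfolding of `archUnipotentHom`. [folklore] -/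
@[simp]
theorem archUnipotentHom_apply (x : Multiplicative (mixedSpace K)) :
    archUnipotentHom K x = archUnipotentAdelic K x.toAdd := rfl

/-- **The right regular representation restricted to the archimedean unipotent line**: a strongly
continuous unitary representation of the additive group `K_∞` on `L²(GL_2(K) A_G \ GL_2(𝔸_K))`.
[cite: JacquetShalikaAJM1981, §4] -/
def archUnipotentRep : UnitaryRep (Multiplicative (mixedSpace K)) ((AdelicGroupData.gl 2 K).L2 μ) :=
  ((AdelicGroupData.gl 2 K).rightRegularUnitaryRep μ
    (AdelicGroupData.isStronglyContinuous_rightRegular_holds (AdelicGroupData.gl 2 K) μ)).restrict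
    (archUnipotentHom K)

/-- `archUnipotentRep μ (ofAdd x) = R((n(x), 1))`. [folklore] -/
@[simp]
theorem archUnipotentRep_apply (x : mixedSpace K) :
    archUnipotentRep μ (Multiplicative.ofAdd x) = (AdelicGroupData.gl 2 K).rightRegular μ (archUnipotentAdelic K x) :=
  rfl

/-- **Matrix coefficients at a torus translate are dilated**:
`⟪R(a(y))f, U_x R(a(y))f⟫ = ⟪f, U_{y⁻¹x} f⟫`. [cite: JacquetShalikaAJM1981, §4] -/
theorem matrixCoeff_rightRegular_archDilation (y : (mixedSpace K)ˣ) (f : (AdelicGroupData.gl 2 K).L2 μ)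
    (x : mixedSpace K) :
    (archUnipotentRep μ).matrixCoeff ((AdelicGroupData.gl 2 K).rightRegular μ (archDilationAdelic K y) f)
        ((AdelicGroupData.gl 2 K).rightRegular μ (archDilationAdelic K y) f) x =
      (archUnipotentRep μ).matrixCoeff f f (((y⁻¹ : (mixedSpace K)ˣ) : mixedSpace K) * x) := by
  rw [UnitaryRep.matrixCoeff_apply, UnitaryRep.matrixCoeff_apply, archUnipotentRep_apply, archUnipotentRep_apply]
  exact inner_rightRegular_archDilation_conj μ y x f

/-! ### The multiplication action of `K_∞ˣ` and the dilation integral -/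

variable (K) in
/-- **The linear action of `K_∞ˣ` on `K_∞` by multiplication**, `y ↦ (ξ ↦ y ξ)`. [folklore] -/
def mixedMulAct : (mixedSpace K)ˣ →* (mixedSpace K →ₗ[ℝ] mixedSpace K) :=
  (Algebra.lmul ℝ (mixedSpace K)).toMonoidHom.comp (Units.coeHom (mixedSpace K))

omit [NumberField K] in
/-- Unfolding of `mixedMulAct`. [folklore] -/
@[simp]
theorem mixedMulAct_apply (y : (mixedSpace K)ˣ) (ξ : mixedSpace K) : mixedMulAct K y ξ = (y : mixedSpace K) * ξ :=
  rfl

omit [NumberField K] in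
/-- The action is jointly continuous, `(y, ξ) ↦ y⁻¹ ξ` included. [folklore] -/
theorem continuous_mixedMulAct_inv_uncurry :
    Continuous fun p : (mixedSpace K)ˣ × mixedSpace K => mixedMulAct K p.1⁻¹ p.2 := by
  simp only [mixedMulAct_apply]
  exact ((Units.continuous_val.comp continuous_inv).comp continuous_fst).mul continuous_snd

/-- **The character form is symmetric for the multiplication action**: `B(y ξ, x) = B(ξ, y x)`.
[folklore] -/
theorem archCharForm_mixedMulAct (y : (mixedSpace K)ˣ) (ξ x : mixedSpace K) :
    archCharForm K (mixedMulAct K y ξ) x = archCharForm K ξ (mixedMulAct K y x) := by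
  rw [mixedMulAct_apply, mixedMulAct_apply]
  exact archCharForm_mul_left _ ξ x

omit [NumberField K] in
/-- The orbit of `1` under `K_∞ˣ` is the set of units. [folklore] -/
theorem mem_range_mixedMulAct_one_iff (ξ : mixedSpace K) :
    ξ ∈ Set.range (fun u : (mixedSpace K)ˣ => mixedMulAct K u 1) ↔ IsUnit ξ := by
  simp only [mixedMulAct_apply, mul_one, Set.mem_range]
  exact ⟨fun ⟨u, hu⟩ => hu ▸ u.isUnit, fun h => ⟨h.unit, rfl⟩⟩

variable [MeasurableSpace (mixedSpace K)ˣ] [BorelSpace (mixedSpace K)ˣ]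

/-- **The dilation integral for `GL_2`** (the abelian half of the `L²`-bound of the global Whittaker
coefficient along the archimedean torus): for `f ∈ L²`, `ν` a left-invariant σ-finite measure on
`K_∞ˣ`, `χ` a measurable multiplicative weight on `K_∞ˣ` and `W` a measurable weight on `K_∞` with
`W(y ξ) = χ(y) W(ξ)`, `W(1) = 1`, and `g ∈ L¹(K_∞)` a kernel whose `B`-Fourier transform
(`B = archCharForm K`) vanishes off the units,
`∫_{K_∞ˣ} χ(y) ‖∫ g(x) U_x (R(a(y)) f) dx‖² dν(y) ≤ (∫_{K_∞ˣ} χ(z) |ĝ(z⁻¹)|² dν(z)) · ∫ W dμ_f`, with `μ_f`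
the spectral measure of `f` (`UnitaryRep.spectralMeasure`).
[cite: JacquetShalikaAJM1981, §4] [cite: Folland1995, Thm. 4.44] -/
theorem lintegral_weight_mul_norm_sq_kirillovKernel_le (f : (AdelicGroupData.gl 2 K).L2 μ)
    (ν : Measure (mixedSpace K)ˣ) [ν.IsMulLeftInvariant] [SFinite ν]
    (χ : (mixedSpace K)ˣ → ℝ≥0∞) (hχm : Measurable χ) (hχ : ∀ y z, χ (y * z) = χ y * χ z)
    (W : mixedSpace K → ℝ≥0∞) (hWm : Measurable W)
    (hW : ∀ (y : (mixedSpace K)ˣ) (ξ : mixedSpace K), W ((y : mixedSpace K) * ξ) = χ y * W ξ) (hW1 : W 1 = 1)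
    (lam : Measure (mixedSpace K)) [SFinite lam] {g : mixedSpace K → ℂ} (hg : Integrable g lam)
    (hg0 : ∀ ξ : mixedSpace K, ¬ IsUnit ξ → ∫ x, g x * cexp ((archCharForm K ξ x : ℝ) * I) ∂lam = 0) :
    ∫⁻ y, χ y * ENNReal.ofReal (‖∫ x, g x • (AdelicGroupData.gl 2 K).rightRegular μ (archUnipotentAdelic K x)
        ((AdelicGroupData.gl 2 K).rightRegular μ (archDilationAdelic K y) f) ∂lam‖ ^ 2) ∂ν ≤
      (∫⁻ z, χ z * ENNReal.ofReal
          (‖∫ x, g x * cexp ((archCharForm K ((z⁻¹ : (mixedSpace K)ˣ) : mixedSpace K) x : ℝ) * I) ∂lam‖ ^ 2) ∂ν) *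
        ∫⁻ ξ, W ξ ∂((archUnipotentRep μ).spectralMeasure (archCharForm K) archCharForm_nondegenerate f) := by
  have h := (archUnipotentRep μ).lintegral_weight_mul_norm_sq_integral_smul_le (archCharForm K)
    archCharForm_nondegenerate (mixedMulAct K)
    (continuous_mixedMulAct_inv_uncurry.measurable) (fun y ξ x => archCharForm_mixedMulAct y ξ x) f
    (fun y => (AdelicGroupData.gl 2 K).rightRegular μ (archDilationAdelic K y) f)
    (fun y x => by rw [mixedMulAct_apply]; exact matrixCoeff_rightRegular_archDilation μ y f x)
    ν χ hχm hχ W hWm 1 (fun y ξ => by rw [mixedMulAct_apply]; exact hW y ξ) hW1 lam hg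
    (fun ξ hξ => hg0 ξ (mt (mem_range_mixedMulAct_one_iff ξ).2 hξ))
  simp only [archUnipotentRep_apply, mixedMulAct_apply, mul_one] at h
  convert h using 12 <;> rfl

end Literature.NumberTheory.Automorphic
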